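import Literature.MathematicalPhysics.QuantumLattice.FermionicTreeExpansionBounds
import HarnessLib

/-!
# Counting scripts with their weights: the positivity bound `Σ_s ∫w_s ∏_{ℓ ∈ lines s} y_ℓ ≤ ∏_ℓ (1 + y_ℓ)`

Topic `Literature/Probability/LatticeModels`; a companion of `BattleFederbushWeights.lean` (there:
`Σ_{scripts s with the lines of a given tree} ∫ w_s = 1`, Lemma 2.3 of Mastropietro 2008).  The single-scale
estimates of the tree expansion produce, for every valid script `s`, a factor `∫_{[0,1]^ι} w_s(t) dt` times a
product over its lines of nonnegative numbers `y_ℓ` (the number of ways of attaching the line `ℓ = {u, u'}` to the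
fields of its two clusters times the `L¹` norm of the propagator, `y_ℓ = m_u m_{u'} ‖g‖₁`), and one needs the sum
over all scripts WITHOUT the factorial of the number of orderings.  Instead of Cayley's formula with degrees we use
the POSITIVITY of the Battle–Brydges–Federbush interpolation itself: applied to the polynomial
`f = ∏_ℓ (1 + y_ℓ s_ℓ)` (all `y_ℓ ≥ 0`) the peeling formula `f(1) = Σ_s ∫ w_s (∂^{lines s} f)(σ_s)` has nonnegative
terms, the derivative along the (distinct) lines of a valid script is `∏_{lines} y_ℓ` times the product of the
untouched factors, which is `≥ 1` at every point of the cube, so (**`sum_prod_mul_weight_le`**)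

`Σ_{valid scripts s rooted at v} (∏_{ℓ ∈ lines s} y_ℓ) ∫ w_s ≤ ∏_{ℓ} (1 + y_ℓ)`,

and, by homogeneity, for the scripts with exactly `K` lines (**`sum_prod_mul_weight_le_of_scale`**)
`Σ_{s : K lines} (∏ y_ℓ) ∫ w_s ≤ λ^{-K} ∏_ℓ (1 + λ y_ℓ)` for every `λ > 0`.  Everything is proved; no named fact.

## Sources

V. Mastropietro, *Non-Perturbative Renormalization* (2008), §2.8 Lemma 2.3 (`Mastropietro2008`); D. C. Brydges,
T. Kennedy, J. Stat. Phys. 48 (1987) 19 (positivity of the interpolation weights); G. A. Battle, P. Federbush,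
Lett. Math. Phys. 8 (1984) 55 (`BattleFederbush1984`). [folklore]
-/

noncomputable section

open MvPolynomial Finsupp Finset Literature.RingTheory.MvPolynomial Literature.MeasureTheory.Integral
open Literature.MathematicalPhysics.QuantumLattice

namespace Literature.Probability.LatticeModels

namespace BattleFederbush

variable {τ : Type*} [DecidableEq τ] {R : Type*} [CommRing R]

/-! ### Derivatives of `∏_ℓ (1 + y_ℓ s_ℓ)` -/

/-- The polynomial `∏_{ℓ ∈ T} (1 + y_ℓ s_ℓ)`. [folklore] -/
def onePlusProd (y : τ → R) (T : Finset τ) : MvPolynomial τ R := ∏ t ∈ T, (1 + C (y t) * X t)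

/-- One derivative removes its own factor: `∂_ℓ ∏_{T} (1 + y s) = y_ℓ ∏_{T ∖ ℓ} (1 + y s)` for `ℓ ∈ T`, else `0`.
[folklore] -/
theorem pderiv_onePlusProd (y : τ → R) (T : Finset τ) (ℓ : τ) :
    pderiv ℓ (onePlusProd y T) = if ℓ ∈ T then C (y ℓ) * onePlusProd y (T.erase ℓ) else 0 := by
  unfold onePlusProd
  induction T using Finset.induction_on with
  | empty => simp
  | insert a T ha ih =>
    rw [Finset.prod_insert ha, Derivation.leibniz, ih, smul_eq_mul, smul_eq_mul, map_add, Derivation.map_one_eq_zero,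
      zero_add, Derivation.leibniz, pderiv_C, smul_zero, add_zero, pderiv_X, smul_eq_mul]
    by_cases hℓa : ℓ = a
    · subst hℓa
      rw [if_neg ha, if_pos (Finset.mem_insert_self _ _), Finset.erase_insert ha, Pi.single_eq_same, mul_one, mul_zero,
        zero_add, mul_comm]
    · rw [Pi.single_eq_of_ne (Ne.symm hℓa), mul_zero, mul_zero, add_zero]
      by_cases hℓ : ℓ ∈ T
      · rw [if_pos hℓ, if_pos (Finset.mem_insert_of_mem hℓ), Finset.erase_insert_of_ne (Ne.symm hℓa),
          Finset.prod_insert (fun h => ha (Finset.mem_of_mem_erase h))]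
        ring
      · rw [if_neg hℓ, if_neg, mul_zero]
        rw [Finset.mem_insert, not_or]
        exact ⟨hℓa, hℓ⟩

/-- **Derivatives along distinct lines**: `∂_{ℓ_k} ⋯ ∂_{ℓ_1} ∏_T (1 + y s) = (∏_j y_{ℓ_j}) ∏_{T ∖ lines} (1 + y s)` for a
duplicate-free list of lines inside `T`, else `0`. [folklore] -/
theorem listDeriv_onePlusProd (y : τ → R) : ∀ (L : List τ) (T : Finset τ),
    listDeriv L (onePlusProd y T) =
      if L.Nodup ∧ ∀ ℓ ∈ L, ℓ ∈ T then C ((L.map y).prod) * onePlusProd y (T \ L.toFinset) else 0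
  | [], T => by simp
  | ℓ :: L, T => by
    rw [listDeriv_cons, pderiv_onePlusProd]
    by_cases hℓ : ℓ ∈ T
    · rw [if_pos hℓ, listDeriv_C_mul, listDeriv_onePlusProd y L (T.erase ℓ)]
      have hset : T.erase ℓ \ L.toFinset = T \ (ℓ :: L).toFinset := by
        ext t
        simp only [Finset.mem_sdiff, Finset.mem_erase, List.mem_toFinset, List.mem_cons, not_or]
        tauto
      by_cases h : (ℓ :: L).Nodup ∧ ∀ ℓ' ∈ ℓ :: L, ℓ' ∈ T
      · have h' : L.Nodup ∧ ∀ ℓ' ∈ L, ℓ' ∈ T.erase ℓ :=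
          ⟨(List.nodup_cons.1 h.1).2, fun ℓ' hℓ' => Finset.mem_erase.2
            ⟨fun heq => (List.nodup_cons.1 h.1).1 (heq ▸ hℓ'), h.2 ℓ' (List.mem_cons_of_mem _ hℓ')⟩⟩
        rw [if_pos h', if_pos h, hset, ← mul_assoc, ← C_mul, List.map_cons, List.prod_cons]
      · have h' : ¬ (L.Nodup ∧ ∀ ℓ' ∈ L, ℓ' ∈ T.erase ℓ) := fun h' => h
          ⟨List.nodup_cons.2 ⟨fun hmem => (Finset.mem_erase.1 (h'.2 ℓ hmem)).1 rfl, h'.1⟩,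
            fun ℓ' hℓ' => by
              rcases List.mem_cons.1 hℓ' with rfl | hmem
              · exact hℓ
              · exact Finset.mem_of_mem_erase (h'.2 ℓ' hmem)⟩
        rw [if_neg h', if_neg h, mul_zero]
    · rw [if_neg hℓ, listDeriv_zero, if_neg]
      rintro ⟨-, hT⟩
      exact hℓ (hT ℓ (List.mem_cons_self ..))

/-! ### The positivity bound -/

variable {ι : Type*} [Fintype ι] [DecidableEq ι] {v : ι} {k : ℕ}

omit [Fintype ι] in
/-- The decoupled interpolation point is nonnegative on the unit cube. [folklore] -/
theorem Script.eval_decPt_nonneg (s : Script v k) (ℓ : Sym2 ι) {t : ι → ℝ} (ht : t ∈ unitCube ι) :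
    0 ≤ eval t (s.decPt ℝ ℓ) := by
  rw [Script.decPt]
  split_ifs
  · rw [map_zero]
  · rw [Script.livePt, eval_monomial, one_mul, Finsupp.prod]
    exact Finset.prod_nonneg fun i _ => pow_nonneg ((mem_unitCube.1 ht) i).1 _

omit [Fintype ι] in
/-- At the decoupled point of a script, the untouched factors of `∏ (1 + y s)` are `≥ 1` everywhere on the cube.
[folklore] -/
theorem Script.one_le_eval_aeval_onePlusProd (s : Script v k) (y : Sym2 ι → ℝ) (hy : ∀ ℓ, 0 ≤ y ℓ) (T : Finset (Sym2 ι))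
    {t : ι → ℝ} (ht : t ∈ unitCube ι) : 1 ≤ eval t (aeval (s.decPt ℝ) (onePlusProd y T)) := by
  rw [onePlusProd, map_prod, map_prod]
  refine Finset.prod_induction _ (fun x : ℝ => 1 ≤ x) (fun a b ha hb => one_le_mul_of_one_le_of_one_le ha hb) le_rfl
    fun ℓ _ => ?_
  rw [map_add, map_one, map_mul, aeval_C, algebraMap_eq, aeval_X, map_add, map_one, map_mul, eval_C]
  exact le_add_of_nonneg_right (mul_nonneg (hy ℓ) (s.eval_decPt_nonneg ℓ ht))

/-- The terms of the weighted script sum are nonnegative. [folklore] -/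
theorem Script.prod_mul_weight_nonneg (s : Script v k) (y : Sym2 ι → ℝ) (hy : ∀ ℓ, 0 ≤ y ℓ) :
    0 ≤ (if s.Valid then (s.lines.map y).prod * cubeIntegral ι ℝ (s.weight ℝ) else 0) := by
  split_ifs
  · refine mul_nonneg (List.prod_nonneg fun x hx => ?_) (cubeIntegral_nonneg _ fun t ht => FermionicTree.eval_weight_nonneg s ht)
    obtain ⟨ℓ, -, rfl⟩ := List.mem_map.1 hx
    exact hy ℓ
  · exact le_rfl

/-- **The positivity count of scripts with their weights**: for nonnegative line weights `y_ℓ`,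
`Σ_{valid scripts s rooted at v} (∏_{ℓ ∈ lines s} y_ℓ) ∫_{[0,1]^ι} w_s ≤ ∏_ℓ (1 + y_ℓ)` — the Battle–Brydges–Federbush
peeling formula applied to `∏_ℓ (1 + y_ℓ s_ℓ)`, all terms being nonnegative and the untouched factors `≥ 1`.
[cite: Mastropietro2008, §2.8 Lemma 2.3] -/
theorem sum_prod_mul_weight_le (y : Sym2 ι → ℝ) (hy : ∀ ℓ, 0 ≤ y ℓ) (v : ι) :
    ∑ k ∈ range (Fintype.card ι), ∑ s : Script v k,
      (if s.Valid then (s.lines.map y).prod * cubeIntegral ι ℝ (s.weight ℝ) else 0) ≤ ∏ ℓ : Sym2 ι, (1 + y ℓ) := by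
  have hf : eval (fun _ => (1 : ℝ)) (onePlusProd y univ) = ∏ ℓ : Sym2 ι, (1 + y ℓ) := by
    rw [onePlusProd, map_prod]
    exact prod_congr rfl fun ℓ _ => by rw [map_add, map_one, map_mul, eval_C, eval_X, mul_one]
  rw [← hf, Script.eval_one_eq_sum_term (root := v)]
  refine sum_le_sum fun k _ => sum_le_sum fun s _ => ?_
  split_ifs with hs
  · rw [Script.term, Script.lineDeriv_eq, listDeriv_onePlusProd, if_pos ⟨Script.nodup_lines s hs, fun ℓ _ => mem_univ ℓ⟩,
      map_mul (aeval (s.decPt ℝ)), aeval_C, algebraMap_eq]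
    have hc : 0 ≤ (s.lines.map y).prod := List.prod_nonneg fun x hx => by
      obtain ⟨ℓ, -, rfl⟩ := List.mem_map.1 hx
      exact hy ℓ
    have key : (s.lines.map y).prod * cubeIntegral ι ℝ (s.weight ℝ) = cubeIntegral ι ℝ (C ((s.lines.map y).prod) * s.weight ℝ) := by
      rw [← smul_eq_C_mul, map_smul, smul_eq_mul]
    rw [key, ← sub_nonneg, ← map_sub]
    refine cubeIntegral_nonneg _ fun t ht => ?_
    have hG := s.one_le_eval_aeval_onePlusProd y hy (univ \ s.lines.toFinset) ht
    have hw := FermionicTree.eval_weight_nonneg s ht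
    have h0 : 0 ≤ (s.lines.map y).prod * eval t (s.weight ℝ) * (eval t (aeval (s.decPt ℝ) (onePlusProd y (univ \ s.lines.toFinset))) - 1) :=
      mul_nonneg (mul_nonneg hc hw) (sub_nonneg.2 hG)
    rw [map_sub, map_mul, map_mul, map_mul, eval_C]
    nlinarith [h0]
  · exact le_rfl

/-- **The count for scripts with exactly `K` lines, by homogeneity**: for `λ > 0`,
`Σ_{s : K lines} (∏_{lines} y_ℓ) ∫ w_s ≤ λ^{-K} ∏_ℓ (1 + λ y_ℓ)`. [folklore] -/
theorem sum_prod_mul_weight_le_of_scale (y : Sym2 ι → ℝ) (hy : ∀ ℓ, 0 ≤ y ℓ) (v : ι) {lam : ℝ} (hlam : 0 < lam)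
    {K : ℕ} (hK : K < Fintype.card ι) :
    ∑ s : Script v K, (if s.Valid then (s.lines.map y).prod * cubeIntegral ι ℝ (s.weight ℝ) else 0) ≤
      (lam⁻¹) ^ K * ∏ ℓ : Sym2 ι, (1 + lam * y ℓ) := by
  have hy' : ∀ ℓ, 0 ≤ lam * y ℓ := fun ℓ => mul_nonneg hlam.le (hy ℓ)
  have h := sum_prod_mul_weight_le (fun ℓ => lam * y ℓ) hy' v
  have hsingle : ∑ s : Script v K, (if s.Valid then (s.lines.map fun ℓ => lam * y ℓ).prod * cubeIntegral ι ℝ (s.weight ℝ) else 0) ≤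
      ∑ k ∈ range (Fintype.card ι), ∑ s : Script v k,
        (if s.Valid then (s.lines.map fun ℓ => lam * y ℓ).prod * cubeIntegral ι ℝ (s.weight ℝ) else 0) :=
    single_le_sum (f := fun k => ∑ s : Script v k,
      (if s.Valid then (s.lines.map fun ℓ => lam * y ℓ).prod * cubeIntegral ι ℝ (s.weight ℝ) else 0))
      (fun k _ => sum_nonneg fun s _ => s.prod_mul_weight_nonneg _ hy') (mem_range.2 hK)
  have hscale : ∀ s : Script v K, (s.lines.map fun ℓ => lam * y ℓ).prod = lam ^ K * (s.lines.map y).prod := fun s => by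
    rw [List.prod_map_mul, List.map_const', List.prod_replicate, Script.length_lines]
  have hterm : ∀ s : Script v K, (if s.Valid then (s.lines.map y).prod * cubeIntegral ι ℝ (s.weight ℝ) else 0) =
      (lam⁻¹) ^ K * (if s.Valid then (s.lines.map fun ℓ => lam * y ℓ).prod * cubeIntegral ι ℝ (s.weight ℝ) else 0) := by
    intro s
    split_ifs
    · rw [hscale, ← mul_assoc, ← mul_assoc, ← mul_pow, inv_mul_cancel₀ hlam.ne', one_pow, one_mul]
    · rw [mul_zero]
  calc ∑ s : Script v K, (if s.Valid then (s.lines.map y).prod * cubeIntegral ι ℝ (s.weight ℝ) else 0)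
      = (lam⁻¹) ^ K * ∑ s : Script v K, (if s.Valid then (s.lines.map fun ℓ => lam * y ℓ).prod * cubeIntegral ι ℝ (s.weight ℝ) else 0) := by
        rw [Finset.mul_sum]; exact sum_congr rfl fun s _ => hterm s
    _ ≤ (lam⁻¹) ^ K * ∏ ℓ : Sym2 ι, (1 + lam * y ℓ) :=
        mul_le_mul_of_nonneg_left (hsingle.trans h) (pow_nonneg (inv_nonneg.2 hlam.le) K)

end BattleFederbush

end Literature.Probability.LatticeModels
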